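import Literature.Analysis.Toeplitz.OneSidedSeries
import Literature.MathematicalPhysics.QuantumLattice.TwistedHoppingPlaneWaves
import HarnessLib

/-!
# Free-gas (`U = 0`) sector witness for TcThermcert1's K1 family — part 1: the objects and the contour formula

`FreeGasArc.Inputs.esymmW` (elementary symmetric function `e_j` of a `Fintype`-indexed weight family) and the coefficient-extraction
formula `FreeGasArc.Inputs.esymmW_fourierCoeff : ∫_{−π}^{π} e^{−iMφ} ∏ᵢ(1 + t xᵢ e^{iφ}) dφ = 2π e_M(x) t^M`; the free twisted band's
Boltzmann weights `FreeGasArc.freeWeight L β θ k = exp(−β · twistedBand L ![θ,0] 0 k)`, K1's per-spin particle number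
`FreeGasArc.halfCount L = ⌊(7/8)L²/2⌋`, and the skeleton-side copy `FreeGasArc.esymmW` (same body, `esymmW_eq_inputs : … = … := rfl`).
HONEST FRAMING: statements about the FREE (`U = 0`) twisted torus gas and about symmetric functions of explicit reals;
nothing here touches `U = 8`; superconductivity in the Hubbard model is NOT proved (or disproved) by any of this.
Provenance: landed form of the crux workfile `Cruxes/ThermalStiffnessCeilingU8b10_le_1o8/FreeGasArcSkeleton.lean` v4.1 (tree 80a90c42bbb7)
+ `FreeGasArcInputs.lean` (d3c3c585d14e), planner `hubbard-floor-idea-rescuer` g5, card `free-gas-arc-darroch` (crit-1 KEEP);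
hubbard-floor support target ST-K1-U0-1, `--supports stmt-Ventures-26381` (TcThermcert1 crux K1). Split into ≤ 400-line modules
`Theorems/TcThermcert1FreeGas*.lean`.
-/

noncomputable section

namespace Summit.Ventures.CertifiedManyBodySolver.Theorems.FreeGasArc.Inputs

open Finset Real MeasureTheory
open scoped BigOperators

/-- [skeleton §2, verbatim] `e_j(x) = ∑_{S ⊆ ι, |S| = j} ∏_{i ∈ S} xᵢ`. -/
def esymmW {ι : Type} [Fintype ι] [DecidableEq ι] (x : ι → ℝ) (j : ℕ) : ℝ :=
  ∑ S ∈ (Finset.univ : Finset ι).powersetCard j, ∏ i ∈ S, x i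

/-- `esymmW x j` is `Multiset.esymm` of the value multiset of `x`. -/
theorem esymmW_eq_esymm {ι : Type} [Fintype ι] [DecidableEq ι] (x : ι → ℝ) (j : ℕ) :
    esymmW x j = ((Finset.univ : Finset ι).val.map x).esymm j := by
  unfold esymmW
  exact (Finset.esymm_map_val x Finset.univ j).symm

/-! ## §G The contour formula: `e_M(x) t^M` is the `M`-th Fourier coefficient of `φ ↦ ∏ᵢ (1 + t e^{iφ} xᵢ)` -/

/-- **Coefficient extraction (any real fugacity `t`).**
`∫_{−π}^{π} e^{−iMφ} ∏ᵢ (1 + t xᵢ e^{iφ}) dφ = 2π · e_M(x) t^M` — the starting point of the arc/off-arc estimate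
(orthogonality `Literature.Analysis.Toeplitz.integral_exp_int_mul_I` after expanding the product over subsets). -/
theorem esymmW_fourierCoeff {ι : Type} [Fintype ι] [DecidableEq ι] (x : ι → ℝ) (t : ℝ) (M : ℕ) :
    ∫ φ in (-π)..π, Complex.exp (-((M : ℂ) * φ * Complex.I)) *
        ∏ i, ((1 : ℂ) + ((t * x i : ℝ) : ℂ) * Complex.exp (φ * Complex.I))
      = 2 * π * ((esymmW x M * t ^ M : ℝ) : ℂ) := by
  -- expand the product over subsets
  have hexp : ∀ φ : ℝ, ∏ i, ((1 : ℂ) + ((t * x i : ℝ) : ℂ) * Complex.exp (φ * Complex.I))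
      = ∑ S ∈ (Finset.univ : Finset ι).powerset,
          ((t : ℂ) * Complex.exp (φ * Complex.I)) ^ S.card * ∏ i ∈ S, (x i : ℂ) := by
    intro φ
    rw [Finset.prod_one_add]
    refine Finset.sum_congr rfl fun S _ => ?_
    rw [← Finset.prod_const, ← Finset.prod_mul_distrib]
    refine Finset.prod_congr rfl fun i _ => ?_
    push_cast
    ring
  simp_rw [hexp, Finset.mul_sum]
  -- each term is a constant times `e^{i(|S| − M)φ}`
  have hterm_fun : ∀ S : Finset ι, (fun φ : ℝ => Complex.exp (-((M : ℂ) * φ * Complex.I)) *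
      (((t : ℂ) * Complex.exp (φ * Complex.I)) ^ S.card * ∏ i ∈ S, (x i : ℂ)))
      = fun φ : ℝ => ((t : ℂ) ^ S.card * ∏ i ∈ S, (x i : ℂ)) *
          Complex.exp ((((S.card : ℤ) - M : ℤ) : ℂ) * φ * Complex.I) := by
    intro S
    funext φ
    rw [mul_pow, ← Complex.exp_nat_mul]
    have h2 : Complex.exp (-((M : ℂ) * φ * Complex.I)) * Complex.exp ((S.card : ℕ) * (φ * Complex.I))
        = Complex.exp ((((S.card : ℤ) - M : ℤ) : ℂ) * φ * Complex.I) := by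
      rw [← Complex.exp_add]
      congr 1
      push_cast
      ring
    calc Complex.exp (-((M : ℂ) * φ * Complex.I)) *
          ((t : ℂ) ^ S.card * Complex.exp ((S.card : ℕ) * (φ * Complex.I)) * ∏ i ∈ S, (x i : ℂ))
        = (Complex.exp (-((M : ℂ) * φ * Complex.I)) * Complex.exp ((S.card : ℕ) * (φ * Complex.I))) *
            ((t : ℂ) ^ S.card * ∏ i ∈ S, (x i : ℂ)) := by ring
      _ = _ := by rw [h2]; ring
  have hint : ∀ S ∈ (Finset.univ : Finset ι).powerset, IntervalIntegrable (fun φ : ℝ =>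
      Complex.exp (-((M : ℂ) * φ * Complex.I)) *
        (((t : ℂ) * Complex.exp (φ * Complex.I)) ^ S.card * ∏ i ∈ S, (x i : ℂ))) MeasureTheory.volume (-π) π := by
    intro S _
    exact (Continuous.intervalIntegrable (by fun_prop) _ _)
  rw [intervalIntegral.integral_finsetSum hint]
  have hterm : ∀ S : Finset ι, ∫ φ in (-π)..π, Complex.exp (-((M : ℂ) * φ * Complex.I)) *
      (((t : ℂ) * Complex.exp (φ * Complex.I)) ^ S.card * ∏ i ∈ S, (x i : ℂ))
      = if S.card = M then ((t : ℂ) ^ S.card * ∏ i ∈ S, (x i : ℂ)) * (2 * π) else 0 := by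
    intro S
    rw [hterm_fun S, intervalIntegral.integral_const_mul, Literature.Analysis.Toeplitz.integral_exp_int_mul_I]
    by_cases h : S.card = M
    · rw [if_pos (by omega : ((S.card : ℤ) - M : ℤ) = 0), if_pos h]
    · rw [if_neg (by omega : ¬ ((S.card : ℤ) - M : ℤ) = 0), if_neg h, mul_zero]
  rw [Finset.sum_congr rfl (fun S _ => hterm S), ← Finset.sum_filter, ← Finset.powersetCard_eq_filter]
  -- on `powersetCard M`, `|S| = M`
  rw [Finset.sum_congr rfl (fun S hS => by rw [(Finset.mem_powersetCard.1 hS).2]), ← Finset.sum_mul,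
    ← Finset.mul_sum]
  unfold esymmW
  push_cast
  ring

end Summit.Ventures.CertifiedManyBodySolver.Theorems.FreeGasArc.Inputs

namespace Summit.Ventures.CertifiedManyBodySolver.Theorems.FreeGasArc

open Real Finset
open Literature.MathematicalPhysics.QuantumLattice
open Literature.Probability.LatticeModels (TorusSite)
open scoped BigOperators

/-! ## §2 The explicit free-gas objects and the two (former) stubs — both now theorems -/

/-- The twisted one-body Boltzmann weights of the free band on the `L × L` momentum grid (flux `θ` through the `e₁`-cycle,
boost gauge): `w_k(β, θ) = exp(−β ξ_k(θ))`, `ξ_k(θ) = twistedBand L ![θ, 0] 0 k = −2cos(2πk₁/L − θ/L) − 2cos(2πk₂/L)`. -/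
def freeWeight (L : ℕ) (β θ : ℝ) (k : TorusSite 2 L) : ℝ :=
  Real.exp (-β * twistedBand L ![θ, 0] 0 k)

/-- Electrons per spin species in K1's sector at side `L`: `M_L = ⌊(1 − (1 − 7/8)) L²/2⌋ = ⌊7L²/16⌋` (written exactly as
`thermalFluxLogZ L 0 0 (1 − 7/8) β θ` unfolds it). -/
def halfCount (L : ℕ) : ℕ := ⌊(1 - (1 - 7 / 8 : ℝ)) * (L : ℝ) ^ 2 / 2⌋₊

/-- The `j`-th elementary symmetric function of a weight family `x : ι → ℝ`: `e_j(x) = ∑_{S ⊆ ι, |S| = j} ∏_{i ∈ S} xᵢ`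
(the canonical `j`-particle partition function of ONE free spin species when `xᵢ = e^{−βεᵢ}`). -/
def esymmW {ι : Type} [Fintype ι] [DecidableEq ι] (x : ι → ℝ) (j : ℕ) : ℝ :=
  ∑ S ∈ (Finset.univ : Finset ι).powersetCard j, ∏ i ∈ S, x i

/-- The skeleton's `esymmW` is the companion module's `esymmW` (same body). -/
theorem esymmW_eq_inputs {ι : Type} [Fintype ι] [DecidableEq ι] (x : ι → ℝ) (j : ℕ) :
    esymmW x j = FreeGasArc.Inputs.esymmW x j := rfl

end Summit.Ventures.CertifiedManyBodySolver.Theorems.FreeGasArc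

end
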